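import Literature.Barriers.CriticalPhenomena.RigorousRGSmallParameterTphiLaplacian
import HarnessLib

/-!
# `RigorousRGSmallParameter` (Slade, Theorem 1.4.1): the `T_φ` seminorm of [BS-rg-norm] —
# VIII. Powers of the Laplacian, the truncated heat semigroup `e^{tΔ_C}` on polynomials, and
# Brydges–Slade Proposition 3.8.1 (eDC): `‖e^{tΔ_C}F‖_{T_φ} ≤ e^{|t|A(A-1)‖C‖_Φ}‖F‖_{T_φ}`

Sequel of `RigorousRGSmallParameterTphiLaplacian.lean`. [BS-rg-norm] Proposition 3.8.1, second
display: "`‖e^{tΔ_C}F‖ ≤ e^{|t|A²‖C‖_Φ}‖F‖_{T_φ}`", with the printed remark "Note that (eDC) follows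
from `‖e^{tΔ_C}‖ ≤ Σ_{n=0}^∞ (1/n!)‖tΔ_C‖ⁿ` together with (DCK)" — on polynomials of degree `≤ A`
the exponential series is finite (`Δ_C` lowers the degree by two), and the Gaussian expectation is
`E_Cθ = e^{½Δ_C}` there ((ELap); Slade (4.11)–(4.12)). This file formalises the remark:

* `lapPow` (`Δ_C^k`), `contDiff_lapPow`, **`coeff_lapC_eq_zero`**, **`coeff_lapPow_eq_zero`**
  (degree bookkeeping: if the coefficients of `F` of length `> A` vanish at `φ`, those of `Δ_C^kF`
  of length `> A - 2k` vanish at `φ`; `lapPow_apply_eq_zero`: `Δ_C^kF(φ) = 0` for `2k > A`);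
* `expLap` — `e^{tΔ_C}F = Σ_{k ≤ A}(t^k/k!)Δ_C^kF` on functions of degree `≤ A`;
* **`TphiNorm_lapPow_le`** (`‖Δ_C^kF‖_{T_φ(𝔥)} ≤ (2binom(A,2)K)^k‖F‖_{T_φ(𝔥)}`, iterating
  Lemma 6.1.1 of file VII) and **`TphiNorm_expLap_le`**
  (`‖e^{tΔ_C}F‖_{T_φ(𝔥)} ≤ e^{|t|·2binom(A,2)K}‖F‖_{T_φ(𝔥)}`, `2binom(A,2) = A(A-1) ≤ A²`), for
  the lattice norms `Φ(𝔥)` and `‖C‖_Φ ≤ K` as unit-ball estimates.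

Everything is proved; no named fact. Ledger effect: none on the trust base of the barrier's
reduction chain (`Slade2017_prop822`).
-/

noncomputable section

namespace Literature.Barriers.CriticalPhenomena

namespace LongRangePhi4

namespace Tphi

open Finset
open scoped ContDiff

variable {Ξ : Type*} [Fintype Ξ]
variable {E : Type*} [NormedAddCommGroup E] [NormedSpace ℝ E]

/-! ### Powers of the Laplacian and the degree bookkeeping -/

/-- `Δ_C^k F`. [folklore] -/
def lapPow (e : Ξ → E) (C : Ξ → Ξ → ℝ) : ℕ → (E → ℝ) → (E → ℝ)
  | 0, F => F
  | k + 1, F => lapC e C (lapPow e C k F)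

/-- `Δ_C^0 = id`. [folklore] -/
@[simp] theorem lapPow_zero (e : Ξ → E) (C : Ξ → Ξ → ℝ) (F : E → ℝ) : lapPow e C 0 F = F := rfl

/-- `Δ_C^{k+1} = Δ_C ∘ Δ_C^k`. [folklore] -/
theorem lapPow_succ (e : Ξ → E) (C : Ξ → Ξ → ℝ) (k : ℕ) (F : E → ℝ) :
    lapPow e C (k + 1) F = lapC e C (lapPow e C k F) := rfl

/-- `Δ_C^k F` is smooth. [folklore] -/
theorem contDiff_lapPow (e : Ξ → E) (C : Ξ → Ξ → ℝ) {F : E → ℝ} (hF : ContDiff ℝ ∞ F) :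
    ∀ k, ContDiff ℝ ∞ (lapPow e C k F)
  | 0 => hF
  | k + 1 => contDiff_lapC e C (contDiff_lapPow e C hF k)

/-- **`Δ_C` lowers the degree by two**: if the coefficients of `F` of length `> A` vanish at `φ`,
those of `Δ_CF` of length `> A - 2` vanish at `φ`. [folklore] -/
theorem coeff_lapC_eq_zero (e : Ξ → E) (C : Ξ → Ξ → ℝ) {F : E → ℝ} (hF : ContDiff ℝ ∞ F) {A : ℕ} {φ : E}
    (hpoly : ∀ z : List Ξ, A < z.length → coeff e z F φ = 0) (z : List Ξ) (hz : A < z.length + 2) :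
    coeff e z (lapC e C F) φ = 0 := by
  rw [coeff_lapC e C hF z]
  refine Finset.sum_eq_zero fun u _ => Finset.sum_eq_zero fun v _ => ?_
  rw [hpoly _ (by simp; omega), mul_zero]

/-- Degree bookkeeping for the powers: the coefficients of `Δ_C^kF` of length `> A - 2k` vanish at
`φ`. [folklore] -/
theorem coeff_lapPow_eq_zero (e : Ξ → E) (C : Ξ → Ξ → ℝ) {F : E → ℝ} (hF : ContDiff ℝ ∞ F) {A : ℕ} {φ : E}
    (hpoly : ∀ z : List Ξ, A < z.length → coeff e z F φ = 0) :
    ∀ (k : ℕ) (z : List Ξ), A < z.length + 2 * k → coeff e z (lapPow e C k F) φ = 0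
  | 0, z, hz => hpoly z (by omega)
  | k + 1, z, hz => by
      rw [lapPow_succ]
      exact coeff_lapC_eq_zero e C (contDiff_lapPow e C hF k) (A := A - 2 * k)
        (fun w hw => coeff_lapPow_eq_zero e C hF hpoly k w (by omega)) z (by omega)

/-- `Δ_C^kF(φ) = 0` for `2k > A` when `F` has degree `≤ A` at `φ`. [folklore] -/
theorem lapPow_apply_eq_zero (e : Ξ → E) (C : Ξ → Ξ → ℝ) {F : E → ℝ} (hF : ContDiff ℝ ∞ F) {A : ℕ} {φ : E}
    (hpoly : ∀ z : List Ξ, A < z.length → coeff e z F φ = 0) {k : ℕ} (hk : A < 2 * k) :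
    lapPow e C k F φ = 0 := by
  have := coeff_lapPow_eq_zero e C hF hpoly k [] (by simpa using hk)
  simpa using this

/-! ### The truncated heat semigroup `e^{tΔ_C}` on polynomials of degree `≤ A` -/

/-- `e^{tΔ_C}F = Σ_{k ≤ A} (t^k/k!) Δ_C^kF` for `F` of degree `≤ A` (the terms `2k > A` vanish).
[cite: BrydgesSlade2015RGI, §2.3 (display (ELap): E_Cθ F = e^{½Δ_C}F on polynomials)] -/
def expLap (e : Ξ → E) (C : Ξ → Ξ → ℝ) (A : ℕ) (t : ℝ) (F : E → ℝ) : E → ℝ :=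
  fun φ => ∑ k ∈ range (A + 1), (t ^ k / (k.factorial : ℝ)) * lapPow e C k F φ

/-! ### The bounds for the lattice norms -/

section lattice

variable {Λ : Type*} [AddCommGroup Λ] {ι : Type*} {S : Type*} (step : S → Λ)

/-- **`‖Δ_C^kF‖_{T_φ} ≤ (2binom(A,2)K)^k‖F‖_{T_φ}`** for `F` of degree `≤ A` at `φ`, `‖C‖_Φ ≤ K`.
[cite: BrydgesSlade2015RGI, Proposition 3.8.1 (proof: "‖e^{tΔ_C}‖ ≤ Σ (1/n!)‖tΔ_C‖ⁿ together with (DCK)")] -/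
theorem TphiNorm_lapPow_le [Fintype Λ] [Fintype ι] {𝔥 R : ℝ} (h𝔥 : 0 < 𝔥) (hR : 0 < R) {pΦ pN A : ℕ}
    (hApN : A ≤ pN) (e : Λ × ι → E) {F : E → ℝ} (hF : ContDiff ℝ ∞ F) (φ : E)
    (hpoly : ∀ z : List (Λ × ι), A < z.length → coeff e z F φ = 0)
    (C : Λ × ι → Λ × ι → ℝ) {K : ℝ} (hK : 0 ≤ K)
    (hC : ∀ (v : List (Λ × ι)), v.length = 2 → ∀ β : List (ℕ × S), Adm pΦ 2 β →
      |napply step β (covFn C) v| ≤ K * 𝔥 ^ 2 * (R ^ β.length)⁻¹) :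
    ∀ k : ℕ, TphiNorm pN (latticeFamily step 𝔥 R pΦ) e (lapPow e C k F) φ ≤
      (2 * ((A.choose 2 : ℝ) * K)) ^ k * TphiNorm pN (latticeFamily step 𝔥 R pΦ) e F φ
  | 0 => by simp
  | k + 1 => by
      rw [lapPow_succ, pow_succ]
      have hk := TphiNorm_lapPow_le h𝔥 hR hApN e hF φ hpoly C hK hC k
      -- `Δ_C^kF` has degree `≤ A` at `φ` as well
      have hpolyk : ∀ z : List (Λ × ι), A < z.length → coeff e z (lapPow e C k F) φ = 0 :=
        fun z hz => coeff_lapPow_eq_zero e C hF hpoly k z (by omega)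
      have h := TphiNorm_lapC_le step h𝔥 hR hApN e (contDiff_lapPow e C hF k) φ hpolyk C hK hC
      rw [inv_mul_le_iff₀ (by norm_num : (0:ℝ) < 2)] at h
      calc TphiNorm pN (latticeFamily step 𝔥 R pΦ) e (lapC e C (lapPow e C k F)) φ
          ≤ 2 * ((A.choose 2 : ℝ) * K * TphiNorm pN (latticeFamily step 𝔥 R pΦ) e (lapPow e C k F) φ) := h
        _ ≤ 2 * ((A.choose 2 : ℝ) * K * ((2 * ((A.choose 2 : ℝ) * K)) ^ k *
              TphiNorm pN (latticeFamily step 𝔥 R pΦ) e F φ)) := by gcongr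
        _ = (2 * ((A.choose 2 : ℝ) * K)) ^ k * (2 * ((A.choose 2 : ℝ) * K)) *
              TphiNorm pN (latticeFamily step 𝔥 R pΦ) e F φ := by ring

/-- **Brydges–Slade, Proposition 3.8.1, second display (eDC), for the lattice norms:**
`‖e^{tΔ_C}F‖_{T_φ} ≤ e^{2|t|binom(A,2)‖C‖_Φ}‖F‖_{T_φ}` (`2binom(A,2) = A(A-1) ≤ A²`) for `F` of degree
`≤ A ≤ p_𝒩` at `φ`. [cite: BrydgesSlade2015RGI, Proposition 3.8.1 (display ‖e^{tΔ_C}F‖ ≤ e^{|t|A²‖C‖_Φ}‖F‖_{T_φ})] -/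
theorem TphiNorm_expLap_le [Fintype Λ] [Fintype ι] {𝔥 R : ℝ} (h𝔥 : 0 < 𝔥) (hR : 0 < R) {pΦ pN A : ℕ}
    (hApN : A ≤ pN) (e : Λ × ι → E) {F : E → ℝ} (hF : ContDiff ℝ ∞ F) (φ : E)
    (hpoly : ∀ z : List (Λ × ι), A < z.length → coeff e z F φ = 0)
    (C : Λ × ι → Λ × ι → ℝ) {K : ℝ} (hK : 0 ≤ K)
    (hC : ∀ (v : List (Λ × ι)), v.length = 2 → ∀ β : List (ℕ × S), Adm pΦ 2 β →
      |napply step β (covFn C) v| ≤ K * 𝔥 ^ 2 * (R ^ β.length)⁻¹) (t : ℝ) :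
    TphiNorm pN (latticeFamily step 𝔥 R pΦ) e (expLap e C A t F) φ ≤
      Real.exp (|t| * (2 * ((A.choose 2 : ℝ) * K))) * TphiNorm pN (latticeFamily step 𝔥 R pΦ) e F φ := by
  set M : ℝ := 2 * ((A.choose 2 : ℝ) * K) with hM
  have hM0 : 0 ≤ M := by positivity
  have hT0 : 0 ≤ TphiNorm pN (latticeFamily step 𝔥 R pΦ) e F φ := TphiNorm_nonneg _ _ _ _ _
  unfold expLap
  have hterms : ∀ k ∈ range (A + 1), ContDiff ℝ ∞ (fun ψ => (t ^ k / (k.factorial : ℝ)) * lapPow e C k F ψ) :=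
    fun k _ => contDiff_const.mul (contDiff_lapPow e C hF k)
  -- subadditivity over the finite sum
  have hsum : ∀ (s : Finset ℕ), (∀ k ∈ s, k ∈ range (A + 1)) →
      TphiNorm pN (latticeFamily step 𝔥 R pΦ) e (fun ψ => ∑ k ∈ s, (t ^ k / (k.factorial : ℝ)) * lapPow e C k F ψ) φ ≤
        ∑ k ∈ s, (|t| ^ k / (k.factorial : ℝ)) * (M ^ k * TphiNorm pN (latticeFamily step 𝔥 R pΦ) e F φ) := by
    classical
    intro s
    induction s using Finset.induction_on with
    | empty =>
      intro _
      simp only [Finset.sum_empty]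
      have := TphiNorm_const_le' h𝔥 hR pN pΦ e φ
      exact this
    | insert b s hb ih =>
      intro hs
      simp only [Finset.sum_insert hb]
      refine (TphiNorm_add_le_lattice step h𝔥 hR pΦ pN e (hterms b (hs b (by simp)))
        (ContDiff.sum fun k hk => hterms k (hs k (by simp [hk]))) φ).trans ?_
      refine add_le_add ?_ (ih fun k hk => hs k (by simp [hk]))
      have h1 : TphiNorm pN (latticeFamily step 𝔥 R pΦ) e (fun ψ => (t ^ b / (b.factorial : ℝ)) * lapPow e C b F ψ) φ ≤
          |t ^ b / (b.factorial : ℝ)| * TphiNorm pN (latticeFamily step 𝔥 R pΦ) e (lapPow e C b F) φ := by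
        unfold TphiNorm
        rw [show coeffFamily e (fun ψ => (t ^ b / (b.factorial : ℝ)) * lapPow e C b F ψ) φ =
          fun z => (t ^ b / (b.factorial : ℝ)) * coeffFamily e (lapPow e C b F) φ z from by
            funext z; simp [coeffFamily, coeff_const_mul e (contDiff_lapPow e C hF b) _ z]]
        exact Tnorm_smul_le (latticeFamily_evalBound step h𝔥 hR pΦ pN) _ _
      refine h1.trans ?_
      rw [abs_div, Nat.abs_cast, abs_pow]
      exact mul_le_mul_of_nonneg_left (TphiNorm_lapPow_le step h𝔥 hR hApN e hF φ hpoly C hK hC b)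
        (by positivity)
  refine (hsum (range (A + 1)) fun k hk => hk).trans ?_
  calc ∑ k ∈ range (A + 1), (|t| ^ k / (k.factorial : ℝ)) * (M ^ k * TphiNorm pN (latticeFamily step 𝔥 R pΦ) e F φ)
      = (∑ k ∈ range (A + 1), (|t| * M) ^ k / (k.factorial : ℝ)) * TphiNorm pN (latticeFamily step 𝔥 R pΦ) e F φ := by
        rw [Finset.sum_mul]
        refine Finset.sum_congr rfl fun k _ => ?_
        rw [mul_pow]; ring
    _ ≤ Real.exp (|t| * M) * TphiNorm pN (latticeFamily step 𝔥 R pΦ) e F φ :=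
        mul_le_mul_of_nonneg_right (Real.sum_le_exp_of_nonneg (by positivity) _) hT0
where
  /-- The zero function has zero seminorm (recorded as `≤ 0`). [folklore] -/
  TphiNorm_const_le' {𝔥 R : ℝ} (h𝔥 : 0 < 𝔥) (hR : 0 < R) (pN pΦ : ℕ) (e : Λ × ι → E) (φ : E) :
      TphiNorm pN (latticeFamily step 𝔥 R pΦ) e (fun _ : E => (0:ℝ)) φ ≤ 0 := by
    unfold TphiNorm
    refine Tnorm_le fun g _ => ?_
    have : coeffFamily e (fun _ : E => (0:ℝ)) φ = fun _ => 0 := by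
      funext z
      cases z with
      | nil => rfl
      | cons a z =>
        simp [coeffFamily, coeff_const_eq_zero' e (a :: z) (by simp)]
    rw [this, pairing_congr_left pN g (F' := fun _ => 0) (fun _ _ => rfl)]
    simp [pairing, sumSeq_zero_fun]
  /-- Coefficients of the zero constant vanish beyond `∅`. [folklore] -/
  coeff_const_eq_zero' (e : Λ × ι → E) : ∀ z : List (Λ × ι), z ≠ [] → coeff e z (fun _ : E => (0:ℝ)) = fun _ => 0
    | [], h => absurd rfl h
    | [a], _ => by funext ψ; simp [coeff_cons, dirDeriv]
    | a :: b :: z, _ => by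
        rw [coeff_cons, coeff_const_eq_zero' e (b :: z) (by simp)]
        funext ψ; simp [dirDeriv]

end lattice

end Tphi

end LongRangePhi4

end Literature.Barriers.CriticalPhenomena

end
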